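import Summits.QuantumFields.YangMills.Theorems.BalabanUVNodesK0AxTangentSocketPsi
import Summits.QuantumFields.YangMills.Theorems.BalabanUVNodesN12DirectSurjHsurj
import Literature.MathematicalPhysics.QuantumFieldTheory.Balaban1983to89.Node00.BgSchemeChartLie
import Summits.QuantumFields.YangMills.Theorems.BalabanUVNodesK0AxSchemeOfRecordLetters
import Literature.MathematicalPhysics.QuantumFieldTheory.Balaban1983to89.T4SmallFieldWindowSandwich

/-!
# NODE O · K0ᴬ — [15] (45) AT THE FLAT CONFIGURATION IS IN THE TREE: `DΨ₀(0)` onto for the canonical flat logarithmic chart from dag-n12's direct surjectivity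
# ✓`N12DirectSurjHsurj.exists_rightInverse_letter` (`𝐁_{k+1}(𝕋) = atScale (k+1)`, `M₁ = 1`, `U₀ = 1`); for `k + 2 ≤ m + K` the (R-a) road displays NO `Ψ`-letter
# — and the def-Y JUNCTION `X := S.lieExpo ∘ unitField` (✓`Node00.BgSchemeChartLie`): (s-exp), `X 0 = 0`, `X ∈ C²` READ from the scheme's Lie letters
# — and the RECORD EDITION at def-Y's scheme of record (✓`…K0AxSchemeOfRecordLetters` §3): the `X`-side letters are def-Y's THEOREMS
# (FILE 9 of the «rooting is a gradient at first order» cut; consumes ✓`…K0AxTangentSocketPsi` (§4g–§4h), ✓`…N12DirectSurjHsurj`, ✓`Node00.BgSchemeChartLie` and ✓`…K0AxSchemeOfRecordLetters` by name)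

LANDING NOTE (porter ▶ PTC-1 g4, 2026-08-31; AUTHORSHIP = ◇ lens-1 g11 «cauchy-analytic», HOME sketch `nodeO-cover/LENS-1g11-TangentSocketOnto-v2.lean` sha16 c285bcca39cd7c53 · 299 l. · 7 thm, no
`def`, 0 sorry (CANDIDATE 7 v2 = FILE 9; supersedes v1 699d05f1 which was never cut: §4i [15] (45) AT THE FLAT CONFIGURATION IS A THEOREM OF THE TREE — FILE 8's `hon` DISCHARGED for `k + 2 ≤ m +
K` via dag-n12's ✓`N12DirectSurjHsurj.exists_rightInverse_letter`; §4j the def-Y JUNCTION at `X := S.lieExpo ∘ unitField`; §4k ★★★★`rootedReceipts_of_tokens_atScale_recordScheme` = the record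
edition over def-Y's ✓p822488 `…K0AxSchemeOfRecordLetters` BY NAME)): landed VERBATIM (only this paragraph added) under the basename ◇ lens-1 proposed
(`…Theorems/BalabanUVNodesK0AxTangentSocketOnto.lean`) as INTENT-62, after ✓p822476 `…K0AxTangentSocketPsi`; imports also ✓`…N12DirectSurjHsurj` (dag-n12), ✓`…K0AxSchemeOfRecordLetters` (def-Y
✓p822488), ✓`Node00.BgSchemeChartLie` (def-Y ✓p821958), ✓`T4SmallFieldWindowSandwich`; `--supports stmt-QuantumFields-27238 --as helper` (NO `--workitem`; kind proof); ◆ CRIT-1 g38's cut: ◆ CRIT-1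
g38 «(A) CUT + J-STAMP: INTENT-62 GO VERBATIM on v2; J4 7∕7 fresh; J1′ on the six scheme letters PASS — with ONE price correction of record: the EVENTUAL Lie token `htok : ∀ᶠ B in 𝓝 0, S.LieTokAt
(unitField B)` is the reality-rows programme's output (✓`BgScheme.lieTokAt_of_regimeTok_of_rows`), inhabited hypothesis-free only AT `B = 0`, load-bearing twice, price MEDIUM (dag-n07-w3 lane) —
NOT «one exact away»; J5′ EXEMPT; (Q-ord) legal; RATE-LEVER neutral; GUARD NOTE: on every record volume `K = recordK₀ F Mc k + n`, `k + 2 ≤ m + K` holds by `omega`, so `hon` is GONE on the whole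
consumer range; SAME-WALL: SURVIVES (priced) — a genuine DISCHARGE (`hon`) plus an honest RELOCATION of the X-side to def-Y's standing tokens; axioms standard on all 7 decls (guarded)» (nodeO
STATUS 2026-08-31T12:14:23Z). HONEST (porter): transport ∕ bookkeeping over tree theorems (dag-n12's right inverse, def-Y's scheme-of-record letters); CONDITIONAL over DISPLAYED letters inhabited
NOWHERE as a package (N07's KNIT tokens, `RegimeTok`, `WAnalyticTok`, `0 < a𝔄`, `dom ∈ 𝓝 1`, `exp ∘ ρ₈ ⊂ SU(2)`, the Lie token along `unitField`, (J-crit′), (J-cons′), D1 ⟨27930⟩, `k + 2 ≤ m +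
K`); (C-tab-opt) STRUCK; nothing of Bałaban asserted, ported, discharged or refuted; K0ᴬ stmt-QuantumFields-27238 ∕ K0⁷ 20541 OPEN — NOTHING of them proved; NODE O 0∕1; COUNT 8∕28 · K 1∕4 UNMOVED;
finite 𝕋⁴ at fixed ε — NOT continuum ∕ OS ∕ Clay; the Yang–Mills mass gap is NOT proved by any of this.

◇ `ymgap-nodeO-lens-1` g11 (planner; typed for the porter ▶ PTC-1; proposed basename `…/Theorems/BalabanUVNodesK0AxTangentSocketOnto.lean`,
`--supports stmt-QuantumFields-27238 --as helper`).  Items: K0ᴬ stmt-QuantumFields-27238 OPEN; K0⁷ stmt-QuantumFields-20541 OPEN.  [15] = [Balaban1985Variational],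
[RS] = [Balaban1985RegularSpaces], [I] = [Balaban1987RG1], [III] = [Balaban1988Convergent].

WHY.  FILE 8 left exactly one `Ψ`-letter on the (R-a) road: `Function.Surjective (fderiv ℝ Ψ₀ 0)` for `Ψ₀ := msChart F 2 K (k+1) (atScale (k+1)) Ū(1) 1` — [15] (45) «`Q(1)` onto»
for the one-scale constraint at the flat configuration.  The N12 width seats PROVED a right inverse of the chart derivative (dag-n12 ★★★`exists_rightInverse_letter`: for `k′ + 1 ≤ m + K`,
every `M₁ ≥ 1`, every `Z` with (2.13)'s divisibility, every datum `W` and every guarded fibre point `U₀` of `𝐁_{k′}(Z)` with small plaquettes on the boxes, some `H` with `DΨ(0) ∘ H = id`).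
At `Z = 𝕋`, `M₁ = 1`, `U₀ = 1`, `k′ = k + 1` every hypothesis is trivial (fibre `rfl`, guard ✓`Node00.smallBelow_avOfRecord_one`, boxes ✓`plaqSmallOn_one`, divisibility `L^{k+1} ∣ 2L^{m+K}`),
and `𝐁_{k+1}(𝕋)` IS `atScale (k+1)` (`bj_univ_eq_atScale`, from ✓`Bj_univ_top` ∕ `Bj_zero` ∕ `Bj_mid` ∕ `Bj_of_gt` ∕ `maxDomT_univ`).  The one price is dag-n12's standing room
`k′ + 1 ≤ m + K`, i.e. `k + 2 ≤ m + K` here: one level above the constraint scale must exist (the last step `k + 1 = m + K` keeps FILE 8's displayed `hon`).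
§4j then DOCKS def-Y's Lie letters (✓p821958 `Node00.BgSchemeChartLie`, record edition ✓p822246 `Node00.BgSchemeOfRecordLie`): with `X := S.lieExpo ∘ unitField` the three
`X`-side letters of FILE 8 are READ — (s-exp) from ✓`BgScheme.chartCfg_comp_eventuallyEq_expChart` (displayed: `S.bg ∘ unitField = 1`, the Lie token eventually along `unitField`),
`X 0 = 0` from ✓`PortU8.unitField_zero` + ✓`BgScheme.lieExpo_eq_zero` (displayed: `S.sol 1 = 0`, `S.𝔄 1 = 0`), `X ∈ C²` from ✓`BgScheme.contDiffAt_lieExpo_comp` (displayed: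
`Continuous S.ev`, `C²` of `B ↦ 𝒜(unitField B) + 𝔄(unitField B)` at `0`) — each displayed letter being exactly what def-Y's record edition proves at `bgSchemeOfRecord … 1 …`
(`bgSchemeOfRecord_continuous_ev`, `_sol_one`, `_𝔄_one`, `_contDiffAt_sol_add_shift_comp_of_regimeTok`, `_lieTokAt_one`), so the record specialisation is one `exact` away
once the KNIT tokens are inhabited at the record scheme (N07 ∕ def-Y business, not asserted here).
§4k (v2) IS that `exact`, against def-Y's ✓`…K0AxSchemeOfRecordLetters` (landed while v1 was being typed): at `S = bgSchemeOfRecord F 2 K (k+1) Ω 1 dom …` the domain letter is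
✓`eventually_unitField_mem` (from `dom ∈ 𝓝 1` and the chart letter `exp ∘ ρ₈ ⊂ SU(2)`), (s-exp) is ✓`chartCfg_unitField_eventuallyEq_expChart_ofRecord` (from the Lie token along `unitField`),
`X 0 = 0` is ✓`lieExpo_unitField_zero_ofRecord` (`RegimeTok`, `1 ∈ dom`), `X ∈ C²` is ✓`contDiffAt_lieExpo_unitField_ofRecord_of_exp_mem` (`RegimeTok`, `1 ∈ dom`, `WAnalyticTok`, `0 < a`, chart letter).

WHAT IS PROVED (kernel, sorry-free, standard axioms; namespace `K0AxCtabUniq`, sections `OntoAtFlat` ∕ `OntoRecord` ∕ `LieJunction` ∕ `RecordScheme`).  `bj_univ_eq_atScale (M₁ j) : Bj M₁ Set.univ j = atScale j`;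
`surjective_fderiv_msChart_of_detSet_eq` (transport along `𝐁 = 𝐁′` — the chart's target type depends on `𝐁`); ★★ `surjective_fderiv_msChart_flat_atScale (K k) (hk2 : k + 2 ≤ m + K) :
Function.Surjective (fderiv ℝ (msChart F N K (k+1) (atScale (k+1)) (avgFamily (avOfRecord F N K) 1) 1) 0)` (generic `N`); ★★★ `rootedReceipts_of_tokens_atScale_flatLogChart_onto` — binders:
KNIT `(S hR Kc range covers sol_of_isMinOn star_mem star_isMinOn hdom)` at level `k+1` + `hk2` + `(W hW X hSX hX₀ hXc)` + (J-crit′) `FlatCritDictionary F k K Ψ₀` + (J-cons′)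
`FlatConsDictionary F θ k K Ψ₀ (Ψ₀ ∘ X)` ⟹ (∀ a l, four rooted receipts) ∧ TokP9reg♭ᵣ; `exists_datumFamily_unitField`; ★★★ `rootedReceipts_of_tokens_atScale_lieExpo` — the same with
`X := S.lieExpo ∘ unitField` and the `X`-side binders replaced by `(hbg : ∀ B, S.bg (unitField B) = 1) (htok : ∀ᶠ B in 𝓝 0, S.LieTokAt (unitField B)) (hsol1 : S.sol 1 = 0) (h𝔄1 : S.𝔄 1 = 0)
(hev : Continuous S.ev) (hC2 : ContDiffAt ℝ 2 (B ↦ S.sol (unitField B) + S.𝔄 (unitField B)) 0)`.  NET DISPLAY on the (R-a) road after FILE 9: KNIT tokens + `RegimeTok` + domain letter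
(N07 ∕ def-Y) · the six scheme letters just listed (each proved by def-Y AT THE RECORD SCHEME, ✓p822246) · (J-crit′), (J-cons′) for `Ψ₀` (DEF-1) · D1 ⟨27930⟩ · guards (`k + 2 ≤ m + K`
among them) — NOTHING on the `Ψ`-side, NOTHING on the `X`-side beyond the scheme's own letters.  ★★★★ `rootedReceipts_of_tokens_atScale_recordScheme` (§4k, v2) — AT THE SCHEME OF
RECORD (`S = bgSchemeOfRecord F 2 K (k+1) Ω 1 dom levB Gp Δ2 a hposπ hposb hQ εC B₀ C₄ a₃ j a𝔄 ε₄`, binders VERBATIM ✓`…K0AxSchemeOfRecordLetters` §3): displayed = `hk2` · N07's KNIT tokens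
`(Kc range covers sol_of_isMinOn star_mem star_isMinOn)` over `S` · `(hT : S.RegimeTok) (hWtok : WAnalyticTok …) (ha𝔄 : 0 < a𝔄) (hd : dom ∈ 𝓝 1)` · `(hρ : ∀ v, exp (θ.ρ8 v) ∈ SU(2))` ·
`(htok : ∀ᶠ B in 𝓝 0, S.LieTokAt (unitField B))` · (J-crit′) · (J-cons′) with datum `Ψ₀ ∘ S.lieExpo ∘ unitField` ⟹ (∀ a l, four rooted receipts) ∧ TokP9reg♭ᵣ.

HONEST.  Bookkeeping over two tree theorems (dag-n12's direct surjectivity; [III] (2.13)'s determining set of the whole torus); CONDITIONAL over the DISPLAYED KNIT ∕ def-Y ∕ DEF-1 letters,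
inhabited NOWHERE; nothing of Bałaban ([15] Thm 1, Prop. 3, Prop. 6–9, (82)–(83), (176)–(178); [RS] (1.113)–(1.114); [III] (2.12); [I] (0.21)) is asserted, ported or discharged beyond what the
tree already proves; (C-tab-opt) stays STRUCK; K0ᴬ 27238 ∕ K0⁷ 20541 OPEN — NOTHING of them proved; NODE O 0∕1; COUNT 8∕28 · K 1∕4 UNMOVED; finite 𝕋⁴_{L^K} at fixed ε — NOT continuum ∕ OS ∕
Clay; **the Yang–Mills mass gap is NOT proved by any of this.**  No `sorry`, no `instance ∕ notation ∕ set_option`; standard axioms.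
-/

noncomputable section

open Filter Topology
open scoped BigOperators Matrix.Norms.L2Operator

namespace Summit.QuantumFields.YangMills.Theorems.K0AxCtabUniq

open Literature.MathematicalPhysics.QuantumFieldTheory.Balaban1983to89
open LatticeFieldCalculus B6SectADomainsV1 B6SectAOperatorsV1 B6SectAVectorModelV1 B6SectACriticalPointV1
open Literature.MathematicalPhysics.QuantumFieldTheory.Balaban1983to89.T4Continuum (T4Family)
open Literature.MathematicalPhysics.QuantumFieldTheory.Balaban1983to89.Node00
open T4RootedResidualGauge (rootGauge)
open GaugeField (gaugeAct)
open B12GaugeOrbits021 (IsResidual OrbitRel)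
open B11Prop6Scheme (mapT)
open Summit.QuantumFields.YangMills.Theorems.K0RecordFormatNames
open Summit.QuantumFields.YangMills.Theorems.K0AxRootGrad

variable (F : T4Family) (θ : Stage13Params F 2)


/-! ### §4f  THE LOCAL (v1.1) EDITION OF THE SUBMERSION LETTER: level sets of `Ψ` lie in the fibres only NEAR each member — the form n07-e's canonical logarithmic chart
`msChart` satisfies (`Node00.IsFibreChartNear`, ✓`isFibreChartNear_msChart`) — and the whole (R-a) chain re-run on it -/

/-! ### §4i  ONTO-NESS OF `DΨ₀(0)` AT THE FLAT CONFIGURATION IS A THEOREM OF THE TREE (dag-n12's direct surjectivity ✓`N12DirectSurjHsurj.exists_rightInverse_letter` at `𝐁_{k+1}(𝕋) = atScale (k+1)`,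
`M₁ = 1`, `U₀ = 1`): for `k + 2 ≤ m + K` the `Ψ`-side of the (R-a) road displays NOTHING -/

section OntoAtFlat

open T4AdjointCovarianceUnitary (lieSU expSU coe_expSU)
open B15DeterminingSets (DetSet MSField AgreeOn avgFamily atScale agreeOn_atScale_iff bondsOf)
open B14.Eq213DetSet (Bj maxDomT Bj_of_gt Bj_zero Bj_mid Bj_top Bj_univ_top maxDomT_univ)
open B14.Eq213MaximalDomains (side)
open Summit.QuantumFields.YangMills.BalabanUVNodes.N12DirectSurjHsurj (exists_rightInverse_letter)
open T4SmallFieldWindowSandwich (plaqSmallOn_one)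

variable {N : ℕ} [NeZero N]

omit [NeZero N] in
/-- **The record determining set of the WHOLE torus is the one-scale set**: `𝐁_j(𝕋) = atScale j` (top member everything, ✓`Bj_univ_top`; every other member empty).
[cite: Balaban1988Convergent, (2.13) pp.256–257; Balaban1987RG1, (0.21) p.256] -/
theorem bj_univ_eq_atScale {P : Params} (M₁ j : ℕ) : Bj M₁ (Set.univ : Set (Site P 0)) j = atScale j := by
  funext n
  rcases lt_trichotomy n j with hnj | rfl | hjn
  · have hne : n ≠ j := ne_of_lt hnj
    rcases Nat.eq_zero_or_pos n with rfl | hn0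
    · rw [Bj_zero hnj, maxDomT_univ, Set.compl_univ]
      simp [atScale, hne]
    · rw [Bj_mid hn0 hnj, maxDomT_univ, maxDomT_univ, sdiff_self, Set.bot_eq_empty]
      simp [atScale, hne]
  · rw [Bj_univ_top]
    simp [atScale]
  · rw [Bj_of_gt hjn]
    simp [atScale, ne_of_gt hjn]

/-- Transport of onto-ness of `DΦ(0)` along an equality of determining sets (the chart's TARGET type depends on `𝐁`). [cite: Balaban1985Variational, (82)–(83) p.290 (bookkeeping)] -/
theorem surjective_fderiv_msChart_of_detSet_eq {K k : ℕ} {𝔹 𝔹' : DetSet (F.P K)} (h : 𝔹 = 𝔹') {W : MSField (F.P K) (SU N)} {U : GaugeField (F.P K) 0 (SU N)}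
    (hs : Function.Surjective (fderiv ℝ (msChart F N K k 𝔹 W U) 0)) : Function.Surjective (fderiv ℝ (msChart F N K k 𝔹' W U) 0) := by
  subst h
  exact hs

/-- ★★ **[15] (45) AT THE FLAT CONFIGURATION, ONE SCALE: `DΨ₀(0)` IS ONTO** for the canonical flat logarithmic chart `Ψ₀ := msChart F N K (k+1) (atScale (k+1)) Ū(1) 1` — dag-n12's
✓`N12DirectSurjHsurj.exists_rightInverse_letter` (a right inverse of the chart derivative at every guarded fibre point of `𝐁_{k+1}(Z)` with small plaquettes on the boxes) at `Z = 𝕋`,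
`M₁ = 1`, `U₀ = 1` (fibre: `rfl`; guard: ✓`smallBelow_avOfRecord_one`; boxes: ✓`plaqSmallOn_one`; divisibility `L^{k+1} ∣ 2L^{m+K}`), transported along `𝐁_{k+1}(𝕋) = atScale (k+1)`.
The price is dag-n12's standing guard `k + 2 ≤ m + K` (one level of room above the constraint scale). [cite: Balaban1985Variational, (44)–(48) p.285, (83) p.290; Balaban1988Convergent, (2.11)–(2.13) pp.256–257] -/
theorem surjective_fderiv_msChart_flat_atScale (K k : ℕ) (hk2 : k + 2 ≤ (F.P K).m + (F.P K).K) :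
    Function.Surjective (fderiv ℝ (msChart F N K (k + 1) (atScale (k + 1)) (avgFamily (avOfRecord F N K) 1) (1 : GaugeField (F.P K) 0 (SU N))) 0) := by
  obtain ⟨ε, hε, h⟩ := exists_rightInverse_letter (F := F) (N := N) (K := K) (k := k + 1) (by omega)
  have hdiv : side (F.P K).L 1 (k + 1) ∣ (F.P K).sitesPerDir 0 := by
    rw [side, Nat.mul_one, Params.sitesPerDir, Nat.sub_zero]
    exact Dvd.dvd.mul_left (Nat.pow_dvd_pow _ (by omega)) 2
  obtain ⟨B, -, hB⟩ := h 1 le_rfl Set.univ hdiv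
  obtain ⟨H, hH, -⟩ := hB (avgFamily (avOfRecord F N K) 1) 1 (fun _ _ _ => rfl) (smallBelow_avOfRecord_one F N (k + 1))
    (fun j _ _ y _ => plaqSmallOn_one _ hε)
  exact surjective_fderiv_msChart_of_detSet_eq F (bj_univ_eq_atScale 1 (k + 1)) fun v => ⟨H v, hH v⟩

end OntoAtFlat

section OntoRecord

open T4AdjointCovarianceUnitary (lieSU expSU coe_expSU)
open B15DeterminingSets (DetSet MSField AgreeOn avgFamily atScale agreeOn_atScale_iff)

/-- ★★★ **THE (R-a) ROAD WITH NO `Ψ`-LETTER** (`k + 2 ≤ m + K`): KNIT tokens + `RegimeTok` + domain letter; (s-exp); `X 0 = 0`, `X` of class `C²` at `0`; (J-crit′) and (J-cons′) for the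
canonical flat logarithmic chart `Ψ₀` (datum `Ψ₀ ∘ X`) ⟹ (∀ a l, the four rooted receipts) ∧ TokP9reg♭ᵣ.  Onto-ness of `DΨ₀(0)` is ✓`surjective_fderiv_msChart_flat_atScale`; everything else on
the `Ψ`-side was derived in §4g–§4h.  CONDITIONAL on the displayed KNIT ∕ def-Y ∕ DEF-1 letters; nothing of [15] asserted beyond the tree's own theorems. [cite: Balaban1985Variational, Thm 1
p.279, (45) p.285, Prop. 6 p.295, (82)–(83) p.290, Prop. 8 p.304, Prop. 9 p.309, (177)–(182) p.306–307; Balaban1985RegularSpaces, (1.113)–(1.114) pp.95–97; Balaban1988Convergent, (2.10)–(2.13) pp.256–257] -/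
theorem rootedReceipts_of_tokens_atScale_flatLogChart_onto {𝒴 𝒵 : Type} [NormedAddCommGroup 𝒴] [NormedSpace ℂ 𝒴] [CompleteSpace 𝒴] [NormedAddCommGroup 𝒵] [NormedSpace ℂ 𝒵]
    (k K : ℕ) (hk2 : k + 2 ≤ (F.P K).m + (F.P K).K) (S : BgScheme F 2 𝒴 𝒵 K (k + 1))
    (hR : S.RegimeTok) (Kc : GaugeField (F.P K) (k + 1) (SU 2) → Set 𝒴)
    (range : ∀ V ∈ S.dom, ∀ A ∈ Kc V, S.chart V A ∈ bgReg F 2 K (k + 1) θ.εbg ∧ Averaging.iter (avOfRecord F 2 K) (k + 1) (S.chart V A) = V)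
    (covers : ∀ V ∈ S.dom, ∀ U : GaugeField (F.P K) 0 (SU 2), U ∈ bgReg F 2 K (k + 1) θ.εbg →
      Averaging.iter (avOfRecord F 2 K) (k + 1) U = V → ∃ A ∈ Kc V, OrbitRel (k + 1) (S.chart V A) U)
    (sol_of_isMinOn : ∀ V ∈ S.dom, ∀ A ∈ Kc V, IsMinOn (wilsonAction4 ∘ S.chart V) (Kc V) A →
      ‖A‖ ≤ S.ε₄ ∧ mapT (S.𝒢 V) 0 (S.W V) (S.J V) (S.𝔄 V) A = A)
    (star_mem : ∀ V ∈ S.dom, S.sol V ∈ Kc V) (star_isMinOn : ∀ V ∈ S.dom, IsMinOn (wilsonAction4 ∘ S.chart V) (Kc V) (S.sol V))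
    (hdom : letI := θ.instVβ₁; letI := θ.instVβ₂;
      ∀ᶠ B in 𝓝 (0 : Fin (F.P K).d → Site (F.P K) (k + 1) → θ.Vβ), unitField F θ k K B ∈ S.dom)
    (W : (Fin (F.P K).d → Site (F.P K) (k + 1) → θ.Vβ) → MSField (F.P K) (SU 2)) (hW : ∀ B, W B (k + 1) = unitField F θ k K B)
    (X : (Fin (F.P K).d → Site (F.P K) (k + 1) → θ.Vβ) → PBond (F.P K) 0 → lieSU (Fin 2))
    (hSX : letI := θ.instVβ₁; letI := θ.instVβ₂;
      (fun B => S.chartCfg (unitField F θ k K B)) =ᶠ[𝓝 (0 : Fin (F.P K).d → Site (F.P K) (k + 1) → θ.Vβ)]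
        fun B => expChart (1 : GaugeField (F.P K) 0 (SU 2)) (X B))
    (hX₀ : letI := θ.instVβ₁; letI := θ.instVβ₂; X 0 = 0) (hXc : letI := θ.instVβ₁; letI := θ.instVβ₂; ContDiffAt ℝ 2 X 0)
    (Jcrit : FlatCritDictionary F k K (msChart F 2 K (k + 1) (atScale (k + 1)) (avgFamily (avOfRecord F 2 K) 1) (1 : GaugeField (F.P K) 0 (SU 2))))
    (Jcons : FlatConsDictionary F θ k K (msChart F 2 K (k + 1) (atScale (k + 1)) (avgFamily (avOfRecord F 2 K) 1) (1 : GaugeField (F.P K) 0 (SU 2)))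
      (fun B => msChart F 2 K (k + 1) (atScale (k + 1)) (avgFamily (avOfRecord F 2 K) 1) (1 : GaugeField (F.P K) 0 (SU 2)) (X B))) :
    (∀ (a : θ.ιβ) (l : RespLabel F k K),
      RootedResponseCriticalModGaugeAt F θ k K a l ∧ RootedResponseOrbitAt F θ k K a l ∧
        RootedResponseInvCriticalAt F θ k K a l ∧ RootedResponseConstraintModGaugeAt F θ k K a l) ∧
    letI := θ.instVβ₁; letI := θ.instVβ₂
    ContDiffAt ℝ 2 (fun B : Fin (F.P K).d → Site (F.P K) (k + 1) → θ.Vβ =>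
      fun (b : PBond (F.P K) 0) (i i' : Fin 2) => ((recordBgField F θ k K B b : SU 2) : Matrix (Fin 2) (Fin 2) ℂ) i i') 0 :=
  rootedReceipts_of_tokens_atScale_flatLogChart F θ k K (by omega) S hR Kc range covers sol_of_isMinOn star_mem star_isMinOn hdom W hW X hSX hX₀ hXc
    (surjective_fderiv_msChart_flat_atScale F K k hk2) Jcrit Jcons

end OntoRecord


/-! ### §4j  THE def-Y JUNCTION: `X := S.lieExpo ∘ unitField` (✓`Node00.BgSchemeChartLie`): (s-exp), `X 0 = 0` and `X ∈ C²` are READ from the scheme's Lie letters -/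

section LieJunction

open T4AdjointCovarianceUnitary (lieSU expSU coe_expSU)
open B15DeterminingSets (DetSet MSField AgreeOn avgFamily atScale agreeOn_atScale_iff)

/-- A datum family through the unit configurations at the constraint scale exists (only its level-`k+1` member is ever read, ✓`agreeOn_atScale_iff`). [folklore] -/
theorem exists_datumFamily_unitField (k K : ℕ) :
    ∃ W : (Fin (F.P K).d → Site (F.P K) (k + 1) → θ.Vβ) → MSField (F.P K) (SU 2), ∀ B, W B (k + 1) = unitField F θ k K B :=
  ⟨fun B j => if h : j = k + 1 then h ▸ unitField F θ k K B else 1, fun B => by simp⟩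

/-- ★★★ **THE (R-a) ROAD AT THE def-Y JUNCTION** (`k + 2 ≤ m + K`; `X := S.lieExpo ∘ unitField`, the scheme's own Lie reading of «U′ = exp(iηA′)», ✓`Node00.BgSchemeChartLie`).
DISPLAYED: the KNIT tokens + `RegimeTok` + domain letter; the scheme's flat background along the unit fields `S.bg (unitField B) = 1`; the Lie token eventually along `unitField`
(✓`BgScheme.lieTokAt_of_rows`' output); zero small field at the flat datum `S.sol 1 = 0`, `S.𝔄 1 = 0` (✓`BgScheme.sol_eq_zero` under the regime; at the record ✓`bgSchemeOfRecord_sol_one` ∕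
`_𝔄_one`); continuity of the presentation `S.ev` and `C²` of `B ↦ 𝒜(unitField B) + 𝔄(unitField B)` at `0` (at the record ✓`bgSchemeOfRecord_continuous_ev` ∕
✓`bgSchemeOfRecord_contDiffAt_sol_add_shift_comp_of_regimeTok`); (J-crit′), (J-cons′) for `Ψ₀` with datum `Ψ₀ ∘ S.lieExpo ∘ unitField` (DEF-1).  DERIVED HERE: (s-exp)
(✓`BgScheme.chartCfg_comp_eventuallyEq_expChart`), `X 0 = 0` (✓`PortU8.unitField_zero`, ✓`BgScheme.lieExpo_eq_zero`), `X ∈ C²` (✓`BgScheme.contDiffAt_lieExpo_comp`), onto-ness (§4i).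
⟹ (∀ a l, the four rooted receipts) ∧ TokP9reg♭ᵣ.  CONDITIONAL on the displayed letters; nothing of [15] asserted. [cite: Balaban1985Variational, (15) p.280, (19)–(20) p.281, (45) p.285,
Prop. 6 p.295, (82)–(83) p.290, Prop. 9 p.309, (177)–(182) pp.306–307; Balaban1985RegularSpaces, (1.113)–(1.114) pp.95–97; Balaban1988Convergent, (2.10)–(2.13) pp.256–257] -/
theorem rootedReceipts_of_tokens_atScale_lieExpo {𝒴 𝒵 : Type} [NormedAddCommGroup 𝒴] [NormedSpace ℂ 𝒴] [CompleteSpace 𝒴] [NormedAddCommGroup 𝒵] [NormedSpace ℂ 𝒵]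
    (k K : ℕ) (hk2 : k + 2 ≤ (F.P K).m + (F.P K).K) (S : BgScheme F 2 𝒴 𝒵 K (k + 1))
    (hR : S.RegimeTok) (Kc : GaugeField (F.P K) (k + 1) (SU 2) → Set 𝒴)
    (range : ∀ V ∈ S.dom, ∀ A ∈ Kc V, S.chart V A ∈ bgReg F 2 K (k + 1) θ.εbg ∧ Averaging.iter (avOfRecord F 2 K) (k + 1) (S.chart V A) = V)
    (covers : ∀ V ∈ S.dom, ∀ U : GaugeField (F.P K) 0 (SU 2), U ∈ bgReg F 2 K (k + 1) θ.εbg →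
      Averaging.iter (avOfRecord F 2 K) (k + 1) U = V → ∃ A ∈ Kc V, OrbitRel (k + 1) (S.chart V A) U)
    (sol_of_isMinOn : ∀ V ∈ S.dom, ∀ A ∈ Kc V, IsMinOn (wilsonAction4 ∘ S.chart V) (Kc V) A →
      ‖A‖ ≤ S.ε₄ ∧ mapT (S.𝒢 V) 0 (S.W V) (S.J V) (S.𝔄 V) A = A)
    (star_mem : ∀ V ∈ S.dom, S.sol V ∈ Kc V) (star_isMinOn : ∀ V ∈ S.dom, IsMinOn (wilsonAction4 ∘ S.chart V) (Kc V) (S.sol V))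
    (hdom : letI := θ.instVβ₁; letI := θ.instVβ₂;
      ∀ᶠ B in 𝓝 (0 : Fin (F.P K).d → Site (F.P K) (k + 1) → θ.Vβ), unitField F θ k K B ∈ S.dom)
    (hbg : ∀ B, S.bg (unitField F θ k K B) = 1)
    (htok : letI := θ.instVβ₁; letI := θ.instVβ₂;
      ∀ᶠ B in 𝓝 (0 : Fin (F.P K).d → Site (F.P K) (k + 1) → θ.Vβ), S.LieTokAt (unitField F θ k K B))
    (hsol1 : S.sol 1 = 0) (h𝔄1 : S.𝔄 1 = 0) (hev : Continuous S.ev)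
    (hC2 : letI := θ.instVβ₁; letI := θ.instVβ₂;
      ContDiffAt ℝ 2 (fun B : Fin (F.P K).d → Site (F.P K) (k + 1) → θ.Vβ => S.sol (unitField F θ k K B) + S.𝔄 (unitField F θ k K B)) 0)
    (Jcrit : FlatCritDictionary F k K (msChart F 2 K (k + 1) (atScale (k + 1)) (avgFamily (avOfRecord F 2 K) 1) (1 : GaugeField (F.P K) 0 (SU 2))))
    (Jcons : FlatConsDictionary F θ k K (msChart F 2 K (k + 1) (atScale (k + 1)) (avgFamily (avOfRecord F 2 K) 1) (1 : GaugeField (F.P K) 0 (SU 2)))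
      (fun B => msChart F 2 K (k + 1) (atScale (k + 1)) (avgFamily (avOfRecord F 2 K) 1) (1 : GaugeField (F.P K) 0 (SU 2)) (S.lieExpo (unitField F θ k K B)))) :
    (∀ (a : θ.ιβ) (l : RespLabel F k K),
      RootedResponseCriticalModGaugeAt F θ k K a l ∧ RootedResponseOrbitAt F θ k K a l ∧
        RootedResponseInvCriticalAt F θ k K a l ∧ RootedResponseConstraintModGaugeAt F θ k K a l) ∧
    letI := θ.instVβ₁; letI := θ.instVβ₂
    ContDiffAt ℝ 2 (fun B : Fin (F.P K).d → Site (F.P K) (k + 1) → θ.Vβ =>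
      fun (b : PBond (F.P K) 0) (i i' : Fin 2) => ((recordBgField F θ k K B b : SU 2) : Matrix (Fin 2) (Fin 2) ℂ) i i') 0 := by
  letI := θ.instVβ₁; letI := θ.instVβ₂
  obtain ⟨W, hW⟩ := exists_datumFamily_unitField F θ k K
  have hX₀ : S.lieExpo (unitField F θ k K 0) = 0 := by
    rw [PortU8.unitField_zero F θ k K]
    exact BgScheme.lieExpo_eq_zero hsol1 h𝔄1
  exact rootedReceipts_of_tokens_atScale_flatLogChart_onto F θ k K hk2 S hR Kc range covers sol_of_isMinOn star_mem star_isMinOn hdom W hW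
    (fun B => S.lieExpo (unitField F θ k K B)) (BgScheme.chartCfg_comp_eventuallyEq_expChart hbg htok) hX₀ (BgScheme.contDiffAt_lieExpo_comp hev hC2) Jcrit Jcons

end LieJunction


/-! ### §4k  THE RECORD EDITION (v2 APPEND): at def-Y's scheme of record `bgSchemeOfRecord F 2 K (k+1) Ω 1 dom …` the `X`-side letters are def-Y's THEOREMS
(✓`…K0AxSchemeOfRecordLetters` §3, ✓`Node00.BgSchemeOfRecordLie`) — the (R-a) road displays N07's KNIT tokens, `RegimeTok`, `WAnalyticTok`, `0 < a`, `dom ∈ 𝓝 1`, the chart letter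
`exp ∘ ρ₈ ⊂ SU(2)`, the Lie token along `unitField`, (J-crit′)∕(J-cons′), D1 and the guards -/

section RecordScheme

open scoped InnerProductSpace
open T4AdjointCovarianceUnitary (lieSU expSU coe_expSU)
open B15DeterminingSets (DetSet MSField AgreeOn avgFamily atScale agreeOn_atScale_iff)
open B11Eq103H1Complex (BondL2K SiteL2K)

/-- ★★★★ **THE (R-a) ROAD AT THE SCHEME OF RECORD** (`S = bgSchemeOfRecord F 2 K (k+1) Ω 1 dom levB Gp Δ2 a hposπ hposb hQ εC B₀ C₄ a₃ j a𝔄 ε₄`, binders VERBATIM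
✓`…K0AxSchemeOfRecordLetters` §3; `k + 2 ≤ m + K`; `X := S.lieExpo ∘ unitField`).  DISPLAYED: N07's KNIT tokens of the record scheme (`Kc range covers sol_of_isMinOn star_mem star_isMinOn`);
def-Y's standing letters `RegimeTok`, `WAnalyticTok`, `0 < a`, `dom ∈ 𝓝 1`; the chart letter `exp (ρ₈ v) ∈ SU(2)` (TRUE at the record's fill, ✓`exp_ρ8_thetaFill_mem`); the Lie token eventually
along `unitField` (the reality programme's output, ✓`BgScheme.lieTokAt_of_rows`; at `B = 0` ✓`lieTokAt_unitField_zero_ofRecord`); (J-crit′), (J-cons′) for `Ψ₀` with datum `Ψ₀ ∘ X` (DEF-1).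
READ from def-Y BY NAME: the domain letter (✓`eventually_unitField_mem`), (s-exp) (✓`chartCfg_unitField_eventuallyEq_expChart_ofRecord`), `X 0 = 0` (✓`lieExpo_unitField_zero_ofRecord`), `X ∈ C²`
(✓`contDiffAt_lieExpo_unitField_ofRecord_of_exp_mem`); onto-ness of `DΨ₀(0)` from §4i.  ⟹ (∀ a l, the four rooted receipts) ∧ TokP9reg♭ᵣ.  CONDITIONAL on the displayed letters, inhabited
nowhere as a package; nothing of [15] asserted. [cite: Balaban1985Variational, Prop. 6 (115)–(117) p.295, Prop. 4 p.292, Prop. 9 p.309, (15) p.280, (19)–(20) p.281, (45) p.285, (82)–(83) p.290,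
(177)–(182) pp.306–307; Balaban1985RegularSpaces, (1.113)–(1.114) pp.95–97; Balaban1988Convergent, (2.10)–(2.13) pp.256–257; Balaban1987RG1, p.264 (before (1.20))] -/
theorem rootedReceipts_of_tokens_atScale_recordScheme (k K : ℕ) (hk2 : k + 2 ≤ (F.P K).m + (F.P K).K)
    [Fact (0 < (F.L : ℝ))] [Fact (0 < (F.P K).eta (k + 1))] [Fact (0 < c0Rec F K (k + 1))] [Fact (∀ c, 0 < wBRec F K (k + 1) c)]
    (Ω : ℕ → Set (Site (F.P K) 0)) (dom : Set (GaugeField (F.P K) (k + 1) (SU 2))) (levB : PBond (F.P K) (k + 1) → ℕ)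
    (Gp : SiteL2K ℂ (F.P K).d (fun _ => (F.P K).sitesPerDir 0) (c0Rec F K (k + 1)) (WRec 2) →ₗ[ℂ]
      SiteL2K ℂ (F.P K).d (fun _ => (F.P K).sitesPerDir 0) (c0Rec F K (k + 1)) (WRec 2))
    (Δ2 : BondL2K ℂ (F.P K).d (fun _ => (F.P K).sitesPerDir 0) (c0Rec F K (k + 1)) (WRec 2) →ₗ[ℂ]
      BondL2K ℂ (F.P K).d (fun _ => (F.P K).sitesPerDir 0) (c0Rec F K (k + 1)) (WRec 2)) (a : ℝ)
    (hposπ : ∀ x, x ≠ 0 → 0 < RCLike.re ⟪x, laplaceAOfRecordAt F 2 (k + 1) (1 : GaugeField (F.P K) 0 (SU 2))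
      (hessOpOfRecord128 F 2 (k + 1) (1 : GaugeField (F.P K) 0 (SU 2)) Gp (QflatOfRecord F 2 (k + 1)) Δ2)
      (QOfRecord F 2 (k + 1) (1 : GaugeField (F.P K) 0 (SU 2))) (QflatOfRecord F 2 (k + 1)) a x⟫_ℂ)
    (hposb : ∀ x, x ≠ 0 → 0 < RCLike.re ⟪x, laplaceAOfRecord F 2 (k + 1) (1 : GaugeField (F.P K) 0 (SU 2))
      (QOfRecord F 2 (k + 1) (1 : GaugeField (F.P K) 0 (SU 2))) (QflatOfRecord F 2 (k + 1)) a x⟫_ℂ)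
    (hQ : Function.Surjective (QOfRecord F 2 (k + 1) (1 : GaugeField (F.P K) 0 (SU 2)))) (εC B₀ C₄ a₃ j a𝔄 ε₄ : ℝ)
    (S : BgSchemeOnLit F 2 K (k + 1) Ω 1) (hS : S = bgSchemeOfRecord F 2 K (k + 1) Ω 1 dom levB Gp Δ2 a hposπ hposb hQ εC B₀ C₄ a₃ j a𝔄 ε₄)
    (hT : S.RegimeTok) (hWtok : WAnalyticTok F 2 K (k + 1) Ω 1 levB Gp a hposb hQ εC a₃) (ha𝔄 : 0 < a𝔄)
    (hd : dom ∈ 𝓝 (1 : GaugeField (F.P K) (k + 1) (SU 2)))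
    (hρ : letI := θ.instVβ₁; letI := θ.instVβ₂; ∀ v : θ.Vβ, NormedSpace.exp (θ.ρ8 v) ∈ Matrix.specialUnitaryGroup (Fin 2) ℂ)
    (Kc : GaugeField (F.P K) (k + 1) (SU 2) → Set (Space115Lit F 2 K (k + 1) Ω 1))
    (range : ∀ V ∈ S.dom, ∀ A ∈ Kc V, S.chart V A ∈ bgReg F 2 K (k + 1) θ.εbg ∧ Averaging.iter (avOfRecord F 2 K) (k + 1) (S.chart V A) = V)
    (covers : ∀ V ∈ S.dom, ∀ U : GaugeField (F.P K) 0 (SU 2), U ∈ bgReg F 2 K (k + 1) θ.εbg →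
      Averaging.iter (avOfRecord F 2 K) (k + 1) U = V → ∃ A ∈ Kc V, OrbitRel (k + 1) (S.chart V A) U)
    (sol_of_isMinOn : ∀ V ∈ S.dom, ∀ A ∈ Kc V, IsMinOn (wilsonAction4 ∘ S.chart V) (Kc V) A →
      ‖A‖ ≤ S.ε₄ ∧ mapT (S.𝒢 V) 0 (S.W V) (S.J V) (S.𝔄 V) A = A)
    (star_mem : ∀ V ∈ S.dom, S.sol V ∈ Kc V) (star_isMinOn : ∀ V ∈ S.dom, IsMinOn (wilsonAction4 ∘ S.chart V) (Kc V) (S.sol V))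
    (htok : letI := θ.instVβ₁; letI := θ.instVβ₂;
      ∀ᶠ B in 𝓝 (0 : Fin (F.P K).d → Site (F.P K) (k + 1) → θ.Vβ), S.LieTokAt (unitField F θ k K B))
    (Jcrit : FlatCritDictionary F k K (msChart F 2 K (k + 1) (atScale (k + 1)) (avgFamily (avOfRecord F 2 K) 1) (1 : GaugeField (F.P K) 0 (SU 2))))
    (Jcons : FlatConsDictionary F θ k K (msChart F 2 K (k + 1) (atScale (k + 1)) (avgFamily (avOfRecord F 2 K) 1) (1 : GaugeField (F.P K) 0 (SU 2)))
      (fun B => msChart F 2 K (k + 1) (atScale (k + 1)) (avgFamily (avOfRecord F 2 K) 1) (1 : GaugeField (F.P K) 0 (SU 2)) (S.lieExpo (unitField F θ k K B)))) :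
    (∀ (a : θ.ιβ) (l : RespLabel F k K),
      RootedResponseCriticalModGaugeAt F θ k K a l ∧ RootedResponseOrbitAt F θ k K a l ∧
        RootedResponseInvCriticalAt F θ k K a l ∧ RootedResponseConstraintModGaugeAt F θ k K a l) ∧
    letI := θ.instVβ₁; letI := θ.instVβ₂
    ContDiffAt ℝ 2 (fun B : Fin (F.P K).d → Site (F.P K) (k + 1) → θ.Vβ =>
      fun (b : PBond (F.P K) 0) (i i' : Fin 2) => ((recordBgField F θ k K B b : SU 2) : Matrix (Fin 2) (Fin 2) ℂ) i i') 0 := by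
  letI := θ.instVβ₁; letI := θ.instVβ₂
  subst hS
  have h1 : (1 : GaugeField (F.P K) (k + 1) (SU 2)) ∈ dom := mem_of_mem_nhds hd
  obtain ⟨W, hW⟩ := exists_datumFamily_unitField F θ k K
  exact rootedReceipts_of_tokens_atScale_flatLogChart_onto F θ k K hk2 _ hT Kc range covers sol_of_isMinOn star_mem star_isMinOn
    (eventually_unitField_mem F θ k K hρ hd) W hW
    (fun B => (bgSchemeOfRecord F 2 K (k + 1) Ω 1 dom levB Gp Δ2 a hposπ hposb hQ εC B₀ C₄ a₃ j a𝔄 ε₄).lieExpo (unitField F θ k K B))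
    (chartCfg_unitField_eventuallyEq_expChart_ofRecord F θ K k Ω dom levB Gp Δ2 a hposπ hposb hQ εC B₀ C₄ a₃ j a𝔄 ε₄ htok)
    (lieExpo_unitField_zero_ofRecord F θ K k Ω dom levB Gp Δ2 a hposπ hposb hQ εC B₀ C₄ a₃ j a𝔄 ε₄ hT h1)
    (contDiffAt_lieExpo_unitField_ofRecord_of_exp_mem F θ K k Ω dom levB Gp Δ2 a hposπ hposb hQ εC B₀ C₄ a₃ j a𝔄 ε₄ hρ hT h1 hWtok ha𝔄)
    Jcrit Jcons

end RecordScheme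

end Summit.QuantumFields.YangMills.Theorems.K0AxCtabUniq

end
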